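import Summits.CriticalPhenomena.PercolationContinuityZ3.Theorems.PercNearOneGluingNoHeavyLowerTailGuardedCIL
import HarnessLib

/-!
# `NoHeavyLowerTail` (stmt-CriticalPhenomena-4575) — CONSTANTS ARE FREE: the (guarded) cumulative isolation
# lemma with ANY constant already closes the crux

Bookkeeping file (lead of the one-cut line, gen 3; `--supports stmt-CriticalPhenomena-4575`).  No definitions, no
named facts, no sorries.

The lead's typed engine `stub_cumulativeIsolation` and its guarded sharpening `stub_guardedCIL`
(`…GuardedCIL.lean`) ask for the SHARP constant `1`:  `μ{1 ≤ N ≤ j} ≤ max_{a∈A} μ{|π(a)| ≤ j}`.  The crux does not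
need sharpness (calibration memo `LEAD-GEN3.md` §1: the crux ≡ the one-cut bound with constants,
`Theorems.noHeavyLowerTail_of_oneCut_const`): this file records the two lossy forms so that a prover with a
constant-losing argument can close the crux by `exact`.

* `fatMinorityLinear_of_cumulativeIsolationConst`, `noHeavyLowerTail_of_cumulativeIsolationConst` — if for some
  `C ≥ 0`, at the half level `j = ⌊|A|/2⌋`, every weighted graph has a relay `a` with
  `μ{1 ≤ N ∧ 2N ≤ |A|} ≤ C · μ{2|π(a)| ≤ |A|}`, then `stub_fatMinorityLinear` holds with `(d₀, C') = (0, 2C)` (pair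
  counting `Theorems.smallBlock_le_two_mul`) and hence the crux.
* `noHeavyLowerTail_of_cumulativeIsolationConst_allLevels` — the same from the all-levels form `… ≤ C · μ{|π(a)| ≤ j}`.
* `cumulativeIsolationConst_of_guardedCILConst`, `noHeavyLowerTail_of_guardedCILConst` — the GUARDED form with a
  constant `C ≥ 1` (`μ({1 ≤ N ≤ j} ∩ {a big block avoids o}) ≤ C · μ({|π(a)| ≤ j} ∩ {a big block avoids a})`)
  gives the unguarded form with the same constant by the event inclusion `GuardedCIL.small_diff_subset` of
  `…GuardedCIL.lean`, hence the crux.  So "guarded event gluing towards the random giant with any constant"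
  (memo §1(b)) is a sufficient target.
-/

noncomputable section

namespace Summit.CriticalPhenomena.PercolationContinuityZ3.Theorems

open MeasureTheory Set Literature.Probability.LatticeModels Literature.Probability.Percolation
open Summit.CriticalPhenomena.PercolationContinuityZ3.Theses.PercNearOneGluing
open scoped Classical BigOperators

/-! ### Half-level CIL with a constant ⇒ fat-minority linear bound ⇒ crux -/

/-- **CIL with a constant ⇒ the fat-minority linear bound** (`d₀ = 0`, constant `2C`).  If for some `C ≥ 0`
every finite weighted graph, every nonempty relay set `A` and every observer `o ∉ A` admit a relay `a ∈ A` with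
`μ{1 ≤ N ∧ 2N ≤ |A|} ≤ C · μ{2|π(a)| ≤ |A|}`, then `μ{0 < N ∧ 2N ≤ |A|} ≤ 2C (μ(o ↮ A) + η)` whenever all
pairwise disconnections are `≤ η`. [this work] -/
theorem fatMinorityLinear_of_cumulativeIsolationConst (C : ℝ) (hC : 0 ≤ C)
    (hCIL : ∀ (n : ℕ) (w : Sym2 (Fin n) → unitInterval) (A : Finset (Fin n)) (o : Fin n),
      A.Nonempty → o ∉ A → ∃ a ∈ A,
        (prodBernoulli w).real {ω : BondConfig (Fin n) |
            1 ≤ (A.filter fun x => ω ∈ openConn o x).card ∧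
              2 * (A.filter fun x => ω ∈ openConn o x).card ≤ A.card} ≤
          C * (prodBernoulli w).real {ω : BondConfig (Fin n) |
            2 * (A.filter fun x => ω ∈ openConn a x).card ≤ A.card}) :
    ∃ (d₀ : ℕ) (C : ℝ), 0 ≤ C ∧ ∀ (n : ℕ) (w : Sym2 (Fin n) → unitInterval) (A : Finset (Fin n))
      (o : Fin n) (η : ℝ), 0 ≤ η → o ∉ A →
      (∀ a ∈ A, ∀ a' ∈ A, (Literature.Probability.LatticeModels.prodBernoulli w).real
        (Literature.Probability.Percolation.openConn a a')ᶜ ≤ η) →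
      (Literature.Probability.LatticeModels.prodBernoulli w).real
          {ω : Literature.Probability.Percolation.BondConfig (Fin n) |
            d₀ < (A.filter fun a => ω ∈ Literature.Probability.Percolation.openConn o a).card ∧
              2 * (A.filter fun a => ω ∈ Literature.Probability.Percolation.openConn o a).card ≤
                A.card} ≤
        C * ((Literature.Probability.LatticeModels.prodBernoulli w).real
          (⋃ a ∈ A, Literature.Probability.Percolation.openConn o a)ᶜ + η) := by
  refine ⟨0, 2 * C, by positivity, fun n w A o η hη ho hpair => ?_⟩
  have hcompl : 0 ≤ (prodBernoulli w).real (⋃ a ∈ A, (openConn o a : Set (BondConfig (Fin n))))ᶜ :=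
    measureReal_nonneg
  rcases A.eq_empty_or_nonempty with hAe | hAne
  · -- no relays: the event is empty
    have hempty : {ω : BondConfig (Fin n) |
        0 < (A.filter fun a => ω ∈ openConn o a).card ∧
          2 * (A.filter fun a => ω ∈ openConn o a).card ≤ A.card} = ∅ := by
      ext ω
      simp [hAe]
    rw [hempty, measureReal_empty]
    nlinarith
  · obtain ⟨a, ha, hle⟩ := hCIL n w A o hAne ho
    have h2 := smallBlock_le_two_mul w A a η ha (fun a' ha' => hpair a ha a' ha')
    have hev : {ω : BondConfig (Fin n) |
        0 < (A.filter fun a => ω ∈ openConn o a).card ∧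
          2 * (A.filter fun a => ω ∈ openConn o a).card ≤ A.card} =
        {ω : BondConfig (Fin n) |
          1 ≤ (A.filter fun x => ω ∈ openConn o x).card ∧
            2 * (A.filter fun x => ω ∈ openConn o x).card ≤ A.card} := by
      ext ω; simp only [Set.mem_setOf_eq]; omega
    rw [hev]
    have h3 : C * (prodBernoulli w).real {ω : BondConfig (Fin n) |
        2 * (A.filter fun x => ω ∈ openConn a x).card ≤ A.card} ≤ C * (2 * η) :=
      mul_le_mul_of_nonneg_left h2 hC
    nlinarith

/-- **The cumulative isolation lemma at the half level WITH ANY CONSTANT closes the crux `NoHeavyLowerTail`.**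
[this work] -/
theorem noHeavyLowerTail_of_cumulativeIsolationConst (C : ℝ) (hC : 0 ≤ C)
    (hCIL : ∀ (n : ℕ) (w : Sym2 (Fin n) → unitInterval) (A : Finset (Fin n)) (o : Fin n),
      A.Nonempty → o ∉ A → ∃ a ∈ A,
        (prodBernoulli w).real {ω : BondConfig (Fin n) |
            1 ≤ (A.filter fun x => ω ∈ openConn o x).card ∧
              2 * (A.filter fun x => ω ∈ openConn o x).card ≤ A.card} ≤
          C * (prodBernoulli w).real {ω : BondConfig (Fin n) |
            2 * (A.filter fun x => ω ∈ openConn a x).card ≤ A.card}) :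
    Summit.CriticalPhenomena.PercolationContinuityZ3.Theses.PercNearOneGluing.NoHeavyLowerTail :=
  noHeavyLowerTail_of_fatMinorityLinear (fatMinorityLinear_of_cumulativeIsolationConst C hC hCIL)

/-- **The all-levels cumulative isolation lemma WITH ANY CONSTANT closes the crux** (the shape of the
registered stub `stub_cumulativeIsolation`, right side multiplied by `C ≥ 0`): instantiate `j := ⌊|A|/2⌋`.
[this work] -/
theorem noHeavyLowerTail_of_cumulativeIsolationConst_allLevels (C : ℝ) (hC : 0 ≤ C)
    (hCIL : ∀ (n : ℕ) (w : Sym2 (Fin n) → unitInterval) (A : Finset (Fin n)) (o : Fin n) (j : ℕ),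
      A.Nonempty → o ∉ A → ∃ a ∈ A,
        (prodBernoulli w).real {ω : BondConfig (Fin n) |
            1 ≤ (A.filter fun x => ω ∈ openConn o x).card ∧
              (A.filter fun x => ω ∈ openConn o x).card ≤ j} ≤
          C * (prodBernoulli w).real {ω : BondConfig (Fin n) |
            (A.filter fun x => ω ∈ openConn a x).card ≤ j}) :
    Summit.CriticalPhenomena.PercolationContinuityZ3.Theses.PercNearOneGluing.NoHeavyLowerTail := by
  refine noHeavyLowerTail_of_cumulativeIsolationConst C hC fun n w A o hA ho => ?_
  obtain ⟨a, ha, hle⟩ := hCIL n w A o (A.card / 2) hA ho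
  refine ⟨a, ha, ?_⟩
  have e1 : {ω : BondConfig (Fin n) |
      1 ≤ (A.filter fun x => ω ∈ openConn o x).card ∧
        2 * (A.filter fun x => ω ∈ openConn o x).card ≤ A.card} =
      {ω : BondConfig (Fin n) |
        1 ≤ (A.filter fun x => ω ∈ openConn o x).card ∧
          (A.filter fun x => ω ∈ openConn o x).card ≤ A.card / 2} := by
    ext ω; simp only [Set.mem_setOf_eq]; omega
  have e2 : {ω : BondConfig (Fin n) | 2 * (A.filter fun x => ω ∈ openConn a x).card ≤ A.card} =
      {ω : BondConfig (Fin n) | (A.filter fun x => ω ∈ openConn a x).card ≤ A.card / 2} := by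
    ext ω; simp only [Set.mem_setOf_eq]; omega
  rw [e1, e2]
  exact hle

/-! ### Guarded CIL with a constant ⇒ CIL with the same constant ⇒ crux -/

/-- **Guarded CIL with a constant `C ≥ 1` gives CIL with the same constant.**  The guard "some block with
more than `j` relays avoids the vertex" is removed by the event inclusion `GuardedCIL.small_diff_subset`
(`{1 ≤ N ≤ j, no big block avoids o} ⊆ {|π(a)| ≤ j, no big block avoids a}`), exactly as in
`Theorems.cumulativeIsolation_of_guardedCIL`. [this work] -/
theorem cumulativeIsolationConst_of_guardedCILConst (C : ℝ) (hC : 1 ≤ C)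
    (hG : ∀ (n : ℕ) (w : Sym2 (Fin n) → unitInterval) (A : Finset (Fin n)) (o : Fin n) (j : ℕ),
      A.Nonempty → o ∉ A → ∃ a ∈ A,
        (prodBernoulli w).real
            ({ω : BondConfig (Fin n) | 1 ≤ (A.filter fun z => ω ∈ openConn o z).card ∧
                (A.filter fun z => ω ∈ openConn o z).card ≤ j} ∩
              {ω | ∃ b ∈ A, ω ∉ openConn o b ∧ j < (A.filter fun z => ω ∈ openConn b z).card}) ≤
          C * (prodBernoulli w).real
            ({ω : BondConfig (Fin n) | (A.filter fun z => ω ∈ openConn a z).card ≤ j} ∩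
              {ω | ∃ b ∈ A, ω ∉ openConn a b ∧ j < (A.filter fun z => ω ∈ openConn b z).card}))
    (n : ℕ) (w : Sym2 (Fin n) → unitInterval) (A : Finset (Fin n)) (o : Fin n) (j : ℕ)
    (hA : A.Nonempty) (ho : o ∉ A) :
    ∃ a ∈ A,
      (prodBernoulli w).real {ω : BondConfig (Fin n) |
          1 ≤ (A.filter fun x => ω ∈ openConn o x).card ∧
            (A.filter fun x => ω ∈ openConn o x).card ≤ j} ≤
        C * (prodBernoulli w).real {ω : BondConfig (Fin n) |
          (A.filter fun x => ω ∈ openConn a x).card ≤ j} := by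
  obtain ⟨a, ha, hle⟩ := hG n w A o j hA ho
  refine ⟨a, ha, ?_⟩
  set μ := prodBernoulli w with hμ
  set L : Set (BondConfig (Fin n)) := {ω | 1 ≤ (A.filter fun x => ω ∈ openConn o x).card ∧
    (A.filter fun x => ω ∈ openConn o x).card ≤ j} with hL
  set R : Set (BondConfig (Fin n)) := {ω | (A.filter fun x => ω ∈ openConn a x).card ≤ j} with hR
  set Bo : Set (BondConfig (Fin n)) :=
    {ω | ∃ b ∈ A, ω ∉ openConn o b ∧ j < (A.filter fun z => ω ∈ openConn b z).card} with hBo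
  set Ba : Set (BondConfig (Fin n)) :=
    {ω | ∃ b ∈ A, ω ∉ openConn a b ∧ j < (A.filter fun z => ω ∈ openConn b z).card} with hBa
  have hmeas : ∀ s : Set (BondConfig (Fin n)), MeasurableSet s := fun _ => MeasurableSet.of_discrete
  have hsplitL : μ.real L = μ.real (L ∩ Bo) + μ.real (L \ Bo) := by
    rw [← measureReal_inter_add_sdiff (hmeas Bo) (measure_ne_top _ _)]
  have hsplitR : μ.real R = μ.real (R ∩ Ba) + μ.real (R \ Ba) := by
    rw [← measureReal_inter_add_sdiff (hmeas Ba) (measure_ne_top _ _)]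
  have hdiff : μ.real (L \ Bo) ≤ μ.real (R \ Ba) :=
    measureReal_mono (GuardedCIL.small_diff_subset A o a j) (measure_ne_top _ _)
  have hnn : 0 ≤ μ.real (R \ Ba) := measureReal_nonneg
  rw [hsplitL, hsplitR, mul_add]
  have h1 : μ.real (L \ Bo) ≤ C * μ.real (R \ Ba) := by nlinarith
  exact add_le_add hle h1

/-- **The guarded cumulative isolation lemma WITH ANY CONSTANT `C ≥ 1` closes the crux `NoHeavyLowerTail`**
(guarded event gluing towards the random giant, with constants, suffices — lead memo LEAD-GEN3.md §1(b)).
[this work] -/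
theorem noHeavyLowerTail_of_guardedCILConst (C : ℝ) (hC : 1 ≤ C)
    (hG : ∀ (n : ℕ) (w : Sym2 (Fin n) → unitInterval) (A : Finset (Fin n)) (o : Fin n) (j : ℕ),
      A.Nonempty → o ∉ A → ∃ a ∈ A,
        (prodBernoulli w).real
            ({ω : BondConfig (Fin n) | 1 ≤ (A.filter fun z => ω ∈ openConn o z).card ∧
                (A.filter fun z => ω ∈ openConn o z).card ≤ j} ∩
              {ω | ∃ b ∈ A, ω ∉ openConn o b ∧ j < (A.filter fun z => ω ∈ openConn b z).card}) ≤
          C * (prodBernoulli w).real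
            ({ω : BondConfig (Fin n) | (A.filter fun z => ω ∈ openConn a z).card ≤ j} ∩
              {ω | ∃ b ∈ A, ω ∉ openConn a b ∧ j < (A.filter fun z => ω ∈ openConn b z).card})) :
    Summit.CriticalPhenomena.PercolationContinuityZ3.Theses.PercNearOneGluing.NoHeavyLowerTail :=
  noHeavyLowerTail_of_cumulativeIsolationConst_allLevels C (le_trans zero_le_one hC)
    (cumulativeIsolationConst_of_guardedCILConst C hC hG)

end Summit.CriticalPhenomena.PercolationContinuityZ3.Theorems
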